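import Literature.AlgebraicGeometry.Frobenioids.RealificationMapInjectiveCountableSupp
import Literature.AlgebraicGeometry.Frobenioids.MonoidFunctorsOnD
import Literature.AnabelianGeometry.EtaleTheta.RealifiedDivisorMonoidsOfRlfR
import HarnessLib

/-!
# [EtTh] Def 3.6 (i): the binder `hBinj` at the CONSTRUCTED data `ofRlfR` (`Λ = ℝ`, `B₀^ℝ := ℝ·Φ₀^birat`) —
# REDUCED to Φ₀-level laws: injective pull-backs of divisors with disjointly supported images of distinct
# primes, over countably many primes

S. Mochizuki, *The étale theta function …*, Publ. RIMS **45** (2009) [MochizukiEtTh2009], Def 3.1 (i)–(iii)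
PDF pp.70–72 (the divisor monoid `Φ` of a tempered Frobenioid: effective Cartier log-divisors on the universal
combinatorial coverings, contravariant in `Y` by PULL-BACK), Def 3.3 (iii) p.73, Def 3.6 (i) p.76
(`B₀^Λ := ℝ·Φ₀^birat ⊆ (Φ₀^ℝ)^gp` for `Λ = ℝ`) [cite: MochizukiEtTh2009, Def 3.6 p.76]; S. Mochizuki, *The
geometry of Frobenioids I* (2008), Def 2.4 (i) p.48 (`M^rlf`), Prop 5.3 p.103 ("the divisor monoid `Φ^rlf`")
[cite: MochizukiFrdI2008, Prop. 5.3 p.103].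

abc-iut cell, seat abc-iut-w5-d153 (gen 4).  PROOF-ONLY (0 defs).  Companion of abc-iut-L2-t3's
`Discharge/Sec3BLambdaInjectiveOfRlf.lean`, which reduces `hBinj : ∀ g, Injective (T.BΛ.map g).hom` at the data
`ofRlfZ` / `ofRlfQ` (`Λ ∈ {ℤ, ℚ}`) to the `B₀`-level clause `hB₀inj` and sets the case `Λ = ℝ` aside ("injectivity of
realified pull-backs is NOT formal", cell findings P53-F1/P53-F2).  Here, for `T := ofRlfR dm hpf`
(`B₀^ℝ = ℝ·Φ₀^birat ⊆ (Φ₀^rlf)^gp`, pull-backs = restrictions of `(Φ₀(g)^rlf)^gp`):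
* `ofRlfR_hBinj_of_rlfMap_injective` — `hBinj` ⟸ the realified pull-backs `Φ₀(g)^rlf` are injective (`Φ₀^rlf(Y)`
  is cancellative, so groupification preserves injectivity; NO `B₀`-level input);
* **`ofRlfR_hBinj_of_disjoint_supp_of_countable`** / `…_of_countable_primes` — `hBinj` ⟸ three Φ₀-LEVEL laws:
  (a) the pull-back maps `Φ₀(g)` are injective, (b) primary elements of DISTINCT primes of `Φ₀(Y)^pf` pull back to
  elements of `Φ₀(Y')^rlf` with DISJOINT supports, (c) every element of `Φ₀(Y)^pf` has COUNTABLE support (resp.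
  `Prime(Φ₀(Y)^pf)` is countable) — by seat abc-iut-w5-d153's `IsPerfFactorial.Rlf.map_injective_of_disjoint_supp_of_countable`
  (`RealificationMapInjectiveCountableSupp.lean`: a homomorphism out of `M^rlf` is computed prime by prime on countably
  supported elements).  For the divisor monoid of Def 3.1 these are print's geometry of pull-back of divisors on the
  special fibre of a tempered covering `Z_∞ → Y_∞` (injective; a prime divisor pulls back to a divisor supported on
  the primes OVER it, and distinct primes have disjoint fibres; countably many irreducible components and cusps,
  cf. GAP-LEDGER G-L2d2-4), laws of the genre the Def 3.3 (iii) interface does not record today (GAP-LEDGER G-w5d179-1).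
HONEST FRAMING: a reduction between explicit hypotheses on abstract data; nothing asserted for the genuine divisor
monoid beyond what a consumer supplies; refereed pre-IUT material; nothing here bears on [IUTchIII] Cor. 3.12.
-/

namespace Literature.AnabelianGeometry.EtaleTheta

open CategoryTheory Opposite Function Literature.AlgebraicGeometry.Frobenioids

universe u v w

namespace RealifiedDivisorMonoids

variable {D₀ : Type u} [Category.{v} D₀] (dm : DivisorMonoids.{u, v, w} D₀)
  (hpf : ∀ Y : D₀ᵒᵖ, IsPerfFactorial (dm.Φ₀.obj Y))

/-- The pull-back of `B₀^ℝ = ℝ·Φ₀^birat` along `g` at `ofRlfR dm hpf` is, on underlying elements of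
`(Φ₀^rlf(Y))^gp`, the groupification of the realified pull-back `Φ₀(g)^rlf`. [cite: MochizukiEtTh2009, Def 3.6 p.76] -/
theorem coe_ofRlfR_BΛ_map {Y Y' : D₀ᵒᵖ} (g : Y ⟶ Y') (c : (ofRlfR dm hpf).BΛ.obj Y) :
    (show ↥(((realData dm hpf).realSpan dm.biratGp).carrier (unop Y')) from ((ofRlfR dm hpf).BΛ.map g).hom c).1 =
      gpMap (IsPerfFactorial.Rlf.map (hpf Y) (hpf Y') (dm.Φ₀.map g).hom)
        (show ↥(((realData dm hpf).realSpan dm.biratGp).carrier (unop Y)) from c).1 := by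
  change pullGp (rlfFunctor dm.Φ₀ hpf) g.unop _ = _
  rw [pullGp, ← gpMap_eq_monGpMap]
  change gpMap (rlfMap dm.Φ₀ hpf g) _ = _
  rw [IsPerfFactorial.Rlf.rlfMap_eq_map]
  rfl

/-- **`hBinj` at `ofRlfR dm hpf` ⟸ the realified pull-backs `Φ₀(g)^rlf : Φ₀(Y)^rlf → Φ₀(Y')^rlf` are injective**
(`B₀^ℝ(g)` is the restriction of `(Φ₀(g)^rlf)^gp` to `ℝ·Φ₀^birat`, and groupification preserves injectivity between
cancellative monoids).  No `B₀`-level input. [cite: MochizukiEtTh2009, Def 3.6 p.76] -/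
theorem ofRlfR_hBinj_of_rlfMap_injective
    (hrlf : ∀ {Y Y' : D₀ᵒᵖ} (g : Y ⟶ Y'),
      Injective (IsPerfFactorial.Rlf.map (hpf Y) (hpf Y') (dm.Φ₀.map g).hom)) :
    ∀ {Y Y' : D₀ᵒᵖ} (g : Y ⟶ Y'), Injective ((ofRlfR dm hpf).BΛ.map g).hom := by
  intro Y Y' g c c' h
  haveI := IsPerfFactorial.Rlf.isCancelMul (hpf Y)
  haveI := IsPerfFactorial.Rlf.isCancelMul (hpf Y')
  have h1 : gpMap (IsPerfFactorial.Rlf.map (hpf Y) (hpf Y') (dm.Φ₀.map g).hom)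
        (show ↥(((realData dm hpf).realSpan dm.biratGp).carrier (unop Y)) from c).1 =
      gpMap (IsPerfFactorial.Rlf.map (hpf Y) (hpf Y') (dm.Φ₀.map g).hom)
        (show ↥(((realData dm hpf).realSpan dm.biratGp).carrier (unop Y)) from c').1 := by
    rw [← coe_ofRlfR_BΛ_map, ← coe_ofRlfR_BΛ_map, h]
  exact Subtype.ext (gpMap_injective _ (hrlf g) h1)

/-- **`hBinj` at `ofRlfR dm hpf` from Φ₀-LEVEL laws**: (a) injective pull-backs `Φ₀(g)`, (b) primary elements of
distinct primes of `Φ₀(Y)^pf` pull back to elements with disjoint supports in `Φ₀(Y')^rlf`, (c) every element of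
`Φ₀(Y)^pf` has countable support — then every pull-back of `B₀^ℝ = ℝ·Φ₀^birat` is injective.
[cite: MochizukiEtTh2009, Def 3.6 p.76] -/
theorem ofRlfR_hBinj_of_disjoint_supp_of_countable
    (hinj : ∀ {Y Y' : D₀ᵒᵖ} (g : Y ⟶ Y'), Injective (dm.Φ₀.map g).hom)
    (hdisj : ∀ {Y Y' : D₀ᵒᵖ} (g : Y ⟶ Y') (𝔭 𝔮 : Primes (Perfection (dm.Φ₀.obj Y))), 𝔭 ≠ 𝔮 →
      ∀ x ∈ 𝔭.carrier, ∀ y ∈ 𝔮.carrier,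
        Disjoint (supp ((hpf Y').toRealification (Perfection.map (dm.Φ₀.map g).hom x) : RlfFactor (dm.Φ₀.obj Y')))
          (supp ((hpf Y').toRealification (Perfection.map (dm.Φ₀.map g).hom y) : RlfFactor (dm.Φ₀.obj Y'))))
    (hcnt : ∀ (Y : D₀ᵒᵖ) (a : Perfection (dm.Φ₀.obj Y)), (supp (factorMap (dm.Φ₀.obj Y) a)).Countable) :
    ∀ {Y Y' : D₀ᵒᵖ} (g : Y ⟶ Y'), Injective ((ofRlfR dm hpf).BΛ.map g).hom :=
  ofRlfR_hBinj_of_rlfMap_injective dm hpf fun {Y Y'} g => fun x y hxy =>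
    IsPerfFactorial.Rlf.eq_of_map_eq_of_countable (hpf Y) (hpf Y') (hinj g) (hdisj g)
      ((hcnt Y _).mono x.2.choose_spec) ((hcnt Y _).mono y.2.choose_spec) hxy

/-- The same with (c) replaced by: `Prime(Φ₀(Y)^pf)` is countable for every `Y` (e.g. countably many irreducible
components and cusps in the special fibre of each connected tempered covering). [cite: MochizukiEtTh2009, Def 3.6 p.76] -/
theorem ofRlfR_hBinj_of_disjoint_supp_of_countable_primes
    (hinj : ∀ {Y Y' : D₀ᵒᵖ} (g : Y ⟶ Y'), Injective (dm.Φ₀.map g).hom)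
    (hdisj : ∀ {Y Y' : D₀ᵒᵖ} (g : Y ⟶ Y') (𝔭 𝔮 : Primes (Perfection (dm.Φ₀.obj Y))), 𝔭 ≠ 𝔮 →
      ∀ x ∈ 𝔭.carrier, ∀ y ∈ 𝔮.carrier,
        Disjoint (supp ((hpf Y').toRealification (Perfection.map (dm.Φ₀.map g).hom x) : RlfFactor (dm.Φ₀.obj Y')))
          (supp ((hpf Y').toRealification (Perfection.map (dm.Φ₀.map g).hom y) : RlfFactor (dm.Φ₀.obj Y'))))
    (hcnt : ∀ Y : D₀ᵒᵖ, Countable (Primes (Perfection (dm.Φ₀.obj Y)))) :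
    ∀ {Y Y' : D₀ᵒᵖ} (g : Y ⟶ Y'), Injective ((ofRlfR dm hpf).BΛ.map g).hom :=
  ofRlfR_hBinj_of_disjoint_supp_of_countable dm hpf hinj hdisj fun Y _ => by
    haveI := hcnt Y
    exact Set.to_countable _

/-! ### Per-morphism (BASE-IMAGE) forms

Consumers at the genuine base key `hBinj` on the image of the base category only (abc-iut-w5-d179's
`hBD : ∀ α, Injective (T.BΛ.map (C₀.base.map α).op).hom`, `Sec3Thm37ivGenuineBaseInj.lean` /
`BiKummerThm44SubModelConnectedBaseInj.lean`: over ALL `G`-sets the universally quantified `hBinj` is false, `B₀(∅) = 1`),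
so the reductions are restated ONE MORPHISM AT A TIME (v2, append-only; seat abc-iut-w5-d153 gen 4). -/

/-- **Per-morphism form of `ofRlfR_hBinj_of_rlfMap_injective`**: the pull-back of `B₀^ℝ = ℝ·Φ₀^birat` along ONE
morphism `g` is injective as soon as the realified pull-back `Φ₀(g)^rlf` is. [cite: MochizukiEtTh2009, Def 3.6 p.76] -/
theorem ofRlfR_BΛ_map_injective_of_rlfMap_injective {Y Y' : D₀ᵒᵖ} (g : Y ⟶ Y')
    (hrlf : Injective (IsPerfFactorial.Rlf.map (hpf Y) (hpf Y') (dm.Φ₀.map g).hom)) :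
    Injective ((ofRlfR dm hpf).BΛ.map g).hom := by
  intro c c' h
  haveI := IsPerfFactorial.Rlf.isCancelMul (hpf Y)
  haveI := IsPerfFactorial.Rlf.isCancelMul (hpf Y')
  have h1 : gpMap (IsPerfFactorial.Rlf.map (hpf Y) (hpf Y') (dm.Φ₀.map g).hom)
        (show ↥(((realData dm hpf).realSpan dm.biratGp).carrier (unop Y)) from c).1 =
      gpMap (IsPerfFactorial.Rlf.map (hpf Y) (hpf Y') (dm.Φ₀.map g).hom)
        (show ↥(((realData dm hpf).realSpan dm.biratGp).carrier (unop Y)) from c').1 := by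
    rw [← coe_ofRlfR_BΛ_map, ← coe_ofRlfR_BΛ_map, h]
  exact Subtype.ext (gpMap_injective _ hrlf h1)

/-- **Per-morphism form of `ofRlfR_hBinj_of_disjoint_supp_of_countable`**: along ONE morphism `g`, the pull-back of
`B₀^ℝ` is injective provided (a) `Φ₀(g)` is injective, (b) primary elements of distinct primes of `Φ₀(Y)^pf` pull back
along `g` to elements with disjoint supports in `Φ₀(Y')^rlf`, (c) every element of `Φ₀(Y)^pf` has countable support.
[cite: MochizukiEtTh2009, Def 3.6 p.76] -/
theorem ofRlfR_BΛ_map_injective_of_disjoint_supp_of_countable {Y Y' : D₀ᵒᵖ} (g : Y ⟶ Y')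
    (hinj : Injective (dm.Φ₀.map g).hom)
    (hdisj : ∀ (𝔭 𝔮 : Primes (Perfection (dm.Φ₀.obj Y))), 𝔭 ≠ 𝔮 → ∀ x ∈ 𝔭.carrier, ∀ y ∈ 𝔮.carrier,
      Disjoint (supp ((hpf Y').toRealification (Perfection.map (dm.Φ₀.map g).hom x) : RlfFactor (dm.Φ₀.obj Y')))
        (supp ((hpf Y').toRealification (Perfection.map (dm.Φ₀.map g).hom y) : RlfFactor (dm.Φ₀.obj Y'))))
    (hcnt : ∀ a : Perfection (dm.Φ₀.obj Y), (supp (factorMap (dm.Φ₀.obj Y) a)).Countable) :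
    Injective ((ofRlfR dm hpf).BΛ.map g).hom :=
  ofRlfR_BΛ_map_injective_of_rlfMap_injective dm hpf g fun x y hxy =>
    IsPerfFactorial.Rlf.eq_of_map_eq_of_countable (hpf Y) (hpf Y') hinj hdisj
      ((hcnt _).mono x.2.choose_spec) ((hcnt _).mono y.2.choose_spec) hxy

/-- The same with (c) replaced by countability of `Prime(Φ₀(Y)^pf)`. [cite: MochizukiEtTh2009, Def 3.6 p.76] -/
theorem ofRlfR_BΛ_map_injective_of_disjoint_supp_of_countable_primes {Y Y' : D₀ᵒᵖ} (g : Y ⟶ Y')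
    (hinj : Injective (dm.Φ₀.map g).hom)
    (hdisj : ∀ (𝔭 𝔮 : Primes (Perfection (dm.Φ₀.obj Y))), 𝔭 ≠ 𝔮 → ∀ x ∈ 𝔭.carrier, ∀ y ∈ 𝔮.carrier,
      Disjoint (supp ((hpf Y').toRealification (Perfection.map (dm.Φ₀.map g).hom x) : RlfFactor (dm.Φ₀.obj Y')))
        (supp ((hpf Y').toRealification (Perfection.map (dm.Φ₀.map g).hom y) : RlfFactor (dm.Φ₀.obj Y'))))
    (hcnt : Countable (Primes (Perfection (dm.Φ₀.obj Y)))) :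
    Injective ((ofRlfR dm hpf).BΛ.map g).hom :=
  ofRlfR_BΛ_map_injective_of_disjoint_supp_of_countable dm hpf g hinj hdisj fun _ => Set.to_countable _

end RealifiedDivisorMonoids

end Literature.AnabelianGeometry.EtaleTheta
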